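import Literature.AlgebraicGeometry.Resolution.DecompletionHensel
import Literature.AlgebraicGeometry.Resolution.DecompletionPolydiscData
import Literature.AlgebraicGeometry.Resolution.SmoothEquivalenceNormalizationProofs
import HarnessLib

/-!
# Temkin's decompletion lemma, algebraic proof — VII. The `m`-side of the Hensel chart

Topic: `Literature/AlgebraicGeometry/Resolution`. M. Temkin, *Inseparable local uniformization*,
J. Algebra 373 (2013) 65–119 = arXiv:0804.1554v3, Lemma 3.3.2 (tree: `Temkin2013_Lemma332_nft`).

The Hensel chart `D₀` (`DecompletionHensel.lean`) is étale over the base ring `A″_j ⊆ K`; here we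
bring the field `m` into it:

* `nrIn_A''`, `isFractionRing_A''`, `isIntegrallyClosed_A''` — `A″_j` is a normal domain with
  fraction field `K` (localizations of `Nr_K(C_j)`) — PROVED;
* the ambient ring `Ω_D = D₀ ⊗_{A″_j} K` with `ι_D : D₀ ↪ Ω_D` injective (flatness) — PROVED;
* `Ξ : m → Ω_D`, `y₀ ↦ ζ` (through `m ≅ k[Y]/(p)`, `adjoinRootToM_bijective`), with
  `Ξ|_k = ι_K|_k` — PROVED;
* **integral elements of `m` land in `D₀`** (`exists_ιD_eq_Ξ`, `θ₀`, `θ₀_add/mul`): `D₀` is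
  smooth over the normal domain `A″_j`, hence integrally closed in `Ω_D`
  (`mem_range_of_isIntegral_tensor_fractionRing`) — PROVED;
* `m° = N[1/f]` for an integral unit `f` of `m°` (`exists_fO`, from
  `Temkin2013_valuationRingOpen_holds`) — PROVED.

All statements are [folklore] except the cited use of Temkin's open-immersion lemma.

## Sources

* M. Temkin, arXiv:0804.1554v3, proof of Lemma 3.3.2 (pp. 45–46) and proof of Thm. 4.1.1 Step 3
  (p. 49).
-/

noncomputable section

open Polynomial

namespace Literature.AlgebraicGeometry.Resolution

universe u

variable {k K m : Type u} [Field k] [Field K] [Algebra k K] [Field m] [Algebra k m]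

/-! ### Normality of the base ring `A″_j` and its fraction field -/

section Normality

variable {V : ValuationSubring k} {O : ValuationSubring m} {A : Subring K}
  {φ : Algebra.adjoin k (A : Set K) →ₐ[k] m}

omit [Algebra k K] in
/-- A localization `S[1/d]` of a subring `S` integrally closed in `K` is integrally closed in `K`.
[folklore] -/
theorem mem_awaySubring_of_isIntegral {S : Subring K} (hS : nrIn S = S) {d : K} (hd : d ∈ S)
    (hd0 : d ≠ 0) {x : K} (hx : IsIntegral (awaySubring S d hd) x) : x ∈ awaySubring S d hd := by
  haveI := isLocalization_awaySubring S hd hd0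
  obtain ⟨⟨m', hm'⟩, hint⟩ := IsIntegral.exists_multiple_integral_of_isLocalization
    (Submonoid.powers (⟨d, hd⟩ : S)) x hx
  obtain ⟨n, rfl⟩ := (Submonoid.mem_powers_iff _ _).mp hm'
  have hint' : IsIntegral S (d ^ n * x) := by
    have h := hint
    rw [Submonoid.smul_def, Algebra.smul_def] at h
    exact h
  have hmem : d ^ n * x ∈ S := by
    rw [← hS]
    exact mem_nrIn_iff.mpr hint'
  exact mem_awaySubring_iff.mpr ⟨n, hmem⟩

omit [Algebra k K] in
/-- `Nr_K(S[1/d]) = S[1/d]` for `S` integrally closed in `K`. [folklore] -/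
theorem nrIn_awaySubring {S : Subring K} (hS : nrIn S = S) {d : K} (hd : d ∈ S) (hd0 : d ≠ 0) :
    nrIn (awaySubring S d hd) = awaySubring S d hd :=
  le_antisymm (fun _ hx => mem_awaySubring_of_isIntegral hS hd hd0 (mem_nrIn_iff.mp hx))
    (le_nrIn _)

namespace DecompChart

variable (C : DecompChart V O A φ)

/-- `Nr_K(A′_j) = A′_j`. [folklore] -/
theorem nrIn_Aj (j : ℕ) : nrIn (C.Aj j) = C.Aj j := by
  rw [Aj, nrIn_nrIn]

/-- `Nr_K(A″₀) = A″₀`. [folklore] -/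
theorem nrIn_A''₀ {j : ℕ} (hj : C.j₀ ≤ j) : nrIn (C.A''₀ hj) = C.A''₀ hj :=
  nrIn_awaySubring (C.nrIn_Aj j) (C.d_mem_Aj hj) C.d_ne_zero

/-- `Nr_K(A″_j) = A″_j`: the base ring of the Hensel chart is integrally closed in `K`.
[folklore] -/
theorem nrIn_A'' {j : ℕ} (hj : C.jH ≤ j) : nrIn (C.A'' hj) = C.A'' hj :=
  nrIn_awaySubring (C.nrIn_A''₀ _) (C.t_mem_A''₀ hj) (C.t_ne_zero hj)

/-- `Frac(A″_j) = K`. [folklore] -/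
instance isFractionRing_A'' {j : ℕ} {hj : C.jH ≤ j} : IsFractionRing (C.A'' hj) K := by
  refine IsFractionRing.of_field _ _ fun z => ?_
  obtain ⟨a, ha, b, hb, rfl⟩ := C.hfrac z
  have hA : A ≤ C.A'' hj := le_trans (C.A_le_Aj j)
    (le_trans (C.Aj_le_A''₀ (le_trans C.j₀_le_jH hj)) (C.A''₀_le_A'' hj))
  exact ⟨⟨a, hA ha⟩, ⟨b, hA hb⟩, rfl⟩

/-- `A″_j` is an integrally closed domain. [folklore] -/
instance isIntegrallyClosed_A'' {j : ℕ} {hj : C.jH ≤ j} : IsIntegrallyClosed (C.A'' hj) := by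
  refine (isIntegrallyClosed_iff K).mpr fun {x} hx => ?_
  have hx' : x ∈ nrIn (C.A'' hj) := mem_nrIn_iff.mpr hx
  rw [C.nrIn_A'' hj] at hx'
  exact ⟨⟨x, hx'⟩, rfl⟩

/-- `k° → A″_j`. [folklore] -/
def baseToA'' {j : ℕ} (hj : C.jH ≤ j) : V →+* C.A'' hj :=
  ((algebraMap k K).comp V.subtype).codRestrict (C.A'' hj)
    fun v => C.A₀_subset_A'' hj (C.algebraMap_mem_A₀ v.2)

/-- `(k° → A″_j)(v) = v` in `K`. [folklore] -/
@[simp] theorem baseToA''_apply_coe {j : ℕ} (hj : C.jH ≤ j) (v : V) :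
    ((C.baseToA'' hj v : C.A'' hj) : K) = algebraMap k K v := rfl

end DecompChart

end Normality

/-! ### The ambient ring `Ω_D = D₀ ⊗_{A″_j} K` and the `m`-side map `Ξ` -/

namespace DecompChart

variable {V : ValuationSubring k} {O : ValuationSubring m} {A : Subring K}
  {φ : Algebra.adjoin k (A : Set K) →ₐ[k] m} (C : DecompChart V O A φ)

section Ambient

variable (e : ℕ) {j : ℕ} (hj : C.jH ≤ j) (hje : C.bp + e + 2 * C.Na ≤ j)

/-- The ambient ring `Ω_D = D₀ ⊗_{A″_j} K` of the Hensel chart: a `K`-algebra containing `D₀`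
(flatness) in which both `K ⊇ k[A]` and `m` (via `y₀ ↦ ζ`) live. [folklore] -/
abbrev ΩD : Type u := TensorProduct (C.A'' hj) (C.D₀ e hj hje) K

/-- `ι_D : D₀ → Ω_D`. [folklore] -/
abbrev ιD : C.D₀ e hj hje →ₐ[C.A'' hj] C.ΩD e hj hje := Algebra.TensorProduct.includeLeft

/-- `ι_K : K → Ω_D`. [folklore] -/
abbrev ιK : K →ₐ[C.A'' hj] C.ΩD e hj hje := Algebra.TensorProduct.includeRight

/-- `ι_D` is injective (`D₀` is flat over the domain `A″_j ⊆ K`). [folklore] -/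
theorem ιD_injective : Function.Injective (C.ιD e hj hje) :=
  Algebra.TensorProduct.includeLeft_injective (S := C.A'' hj) Subtype.val_injective

/-- `ι_K ∘ (A″_j ⊆ K) = ι_D ∘ (A″_j → D₀)`. [folklore] -/
theorem ιK_coe (a : C.A'' hj) :
    C.ιK e hj hje (a : K) = C.ιD e hj hje (algebraMap (C.A'' hj) (C.D₀ e hj hje) a) := by
  rw [← Subring.coe_subtype, show (C.A'' hj).subtype a = algebraMap (C.A'' hj) K a from rfl,
    AlgHom.commutes, AlgHom.commutes]

/-- `k[Y]/(p) → m`, `Y ↦ y₀`. [folklore] -/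
def adjoinRootToM : AdjoinRoot C.p →ₐ[k] m :=
  AdjoinRoot.liftAlgHom C.p (Algebra.ofId k m) C.y₀
    (by
      change Polynomial.eval₂ (algebraMap k m) C.y₀ C.p = 0
      rw [← Polynomial.aeval_def]; exact C.aeval_y₀_p)

/-- `k[Y]/(p) → m` is bijective (`y₀` is a primitive element with minimal polynomial `p`).
[folklore] -/
theorem adjoinRootToM_bijective : Function.Bijective C.adjoinRootToM := by
  haveI := C.hfin
  haveI : Fact (Irreducible C.p) := ⟨minpoly.irreducible (Algebra.IsIntegral.isIntegral C.y₀)⟩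
  refine ⟨C.adjoinRootToM.toRingHom.injective, fun z => ?_⟩
  have hz : z ∈ (⊤ : Subalgebra k m) := Algebra.mem_top
  rw [← IntermediateField.top_toSubalgebra, ← C.adjoin_y₀,
    IntermediateField.adjoin_simple_toSubalgebra_of_isAlgebraic
      (Algebra.IsAlgebraic.isAlgebraic C.y₀),
    Algebra.adjoin_singleton_eq_range_aeval] at hz
  obtain ⟨q, rfl⟩ := hz
  refine ⟨AdjoinRoot.mk C.p q, ?_⟩
  rw [adjoinRootToM, AdjoinRoot.liftAlgHom_mk]
  rfl

/-- `m ≃ k[Y]/(p)` via the primitive element `y₀`. [folklore] -/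
def mEquiv : m ≃ₐ[k] AdjoinRoot C.p :=
  (AlgEquiv.ofBijective C.adjoinRootToM C.adjoinRootToM_bijective).symm

/-- `mEquiv y₀ = root`. [folklore] -/
theorem mEquiv_y₀ : C.mEquiv C.y₀ = AdjoinRoot.root C.p := by
  rw [mEquiv, AlgEquiv.symm_apply_eq, AlgEquiv.ofBijective_apply, adjoinRootToM,
    AdjoinRoot.liftAlgHom_root]

/-- `p(ζ) = 0` in `Ω_D`, for `p` with its `k`-coefficients. [folklore] -/
theorem eval₂_p_ζ : C.p.eval₂ ((C.ιK e hj hje : K →+* C.ΩD e hj hje).comp (algebraMap k K))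
    (C.ιD e hj hje (C.ζ e hj hje)) = 0 := by
  have h1 : C.p.eval₂ ((C.ιK e hj hje : K →+* C.ΩD e hj hje).comp (algebraMap k K))
      (C.ιD e hj hje (C.ζ e hj hje)) = (C.pS hj).eval₂ ((C.ιD e hj hje : C.D₀ e hj hje →+* _).comp
        (algebraMap (C.A'' hj) (C.D₀ e hj hje))) (C.ιD e hj hje (C.ζ e hj hje)) := by
    rw [← Polynomial.eval₂_map, ← pK, ← C.map_pS hj, Polynomial.eval₂_map]
    congr 1
    ext a
    simp only [RingHom.coe_comp, Function.comp_apply, Subring.coe_subtype, AlgHom.coe_toRingHom]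
    exact C.ιK_coe e hj hje a
  rw [h1, show (C.ιD e hj hje) (C.ζ e hj hje) = (C.ιD e hj hje : C.D₀ e hj hje →+* _) (C.ζ e hj hje)
    from rfl, ← Polynomial.hom_eval₂, ← Polynomial.aeval_def, C.aeval_ζ_pS, map_zero]

/-- **`Ξ : m → Ω_D`**, `y₀ ↦ ζ` — the `m`-side of the Hensel chart. [folklore] -/
def Ξ : m →+* C.ΩD e hj hje :=
  (AdjoinRoot.lift ((C.ιK e hj hje : K →+* C.ΩD e hj hje).comp (algebraMap k K))
    (C.ιD e hj hje (C.ζ e hj hje)) (C.eval₂_p_ζ e hj hje)).comp (C.mEquiv : m →+* AdjoinRoot C.p)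

/-- `Ξ(y₀) = ζ`. [folklore] -/
theorem Ξ_y₀ : C.Ξ e hj hje C.y₀ = C.ιD e hj hje (C.ζ e hj hje) := by
  simp only [Ξ, RingHom.coe_comp, Function.comp_apply, RingHom.coe_coe]
  rw [C.mEquiv_y₀, AdjoinRoot.lift_root]

/-- `Ξ` on `k`: `Ξ(c) = ι_K(c)`. [folklore] -/
theorem Ξ_algebraMap (c : k) : C.Ξ e hj hje (algebraMap k m c) = C.ιK e hj hje (algebraMap k K c) := by
  simp only [Ξ, RingHom.coe_comp, Function.comp_apply, RingHom.coe_coe]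
  rw [AlgEquiv.commutes, AdjoinRoot.algebraMap_eq, AdjoinRoot.lift_of]
  rfl

/-- `Ξ` on `k°`: `Ξ(v) = ι_D(v)`. [folklore] -/
theorem Ξ_algebraMap_V (v : V) : C.Ξ e hj hje (algebraMap k m v) =
    C.ιD e hj hje (algebraMap (C.A'' hj) (C.D₀ e hj hje) (C.baseToA'' hj v)) := by
  rw [C.Ξ_algebraMap, ← C.ιK_coe]; rfl

/-- `k°_m → D₀` (through `k° ≅ k°_m`). [folklore] -/
def baseRingToD₀ : baseRing m V →+* C.D₀ e hj hje :=
  ((algebraMap (C.A'' hj) (C.D₀ e hj hje)).comp (C.baseToA'' hj)).comp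
    (V.toSubring.equivMapOfInjective (algebraMap k m) (algebraMap k m).injective).symm.toRingHom

/-- Compatibility `Ξ|_{k°_m} = ι_D ∘ (k°_m → D₀)`. [folklore] -/
theorem Ξ_baseRing (x : baseRing m V) :
    C.Ξ e hj hje (x : m) = C.ιD e hj hje (C.baseRingToD₀ e hj hje x) := by
  set v := (V.toSubring.equivMapOfInjective (algebraMap k m) (algebraMap k m).injective).symm x
    with hv
  have hx : (x : m) = algebraMap k m (v : k) := by
    have := (V.toSubring.equivMapOfInjective (algebraMap k m)
      (algebraMap k m).injective).apply_symm_apply x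
    rw [← hv] at this
    exact (congrArg Subtype.val this).symm
  rw [hx, C.Ξ_algebraMap_V]
  rfl

/-- Integral elements of `m` map to elements of `Ω_D` integral over `D₀`. [folklore] -/
theorem isIntegral_Ξ {ν : m} (hν : IsIntegral (baseRing m V) ν) :
    IsIntegral (C.D₀ e hj hje) (C.Ξ e hj hje ν) := by
  obtain ⟨q, hqm, hq0⟩ := hν
  refine ⟨q.map (C.baseRingToD₀ e hj hje), hqm.map _, ?_⟩
  rw [Polynomial.eval₂_map]
  have : (algebraMap (C.D₀ e hj hje) (C.ΩD e hj hje)).comp (C.baseRingToD₀ e hj hje) =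
      (C.Ξ e hj hje).comp (baseRing m V).subtype := by
    ext x
    simp only [RingHom.coe_comp, Function.comp_apply, Subring.coe_subtype]
    rw [C.Ξ_baseRing]; rfl
  rw [this, ← Polynomial.hom_eval₂]
  change C.Ξ e hj hje (Polynomial.eval₂ (algebraMap _ m) ν q) = 0
  rw [hq0, map_zero]

/-- **Integral elements of `m` land in `D₀`**: `D₀` is smooth over the normal domain `A″_j`,
hence integrally closed in `Ω_D = D₀ ⊗ K`. [folklore] -/
theorem exists_ιD_eq_Ξ {ν : m} (hν : IsIntegral (baseRing m V) ν) :
    ∃! d : C.D₀ e hj hje, C.ιD e hj hje d = C.Ξ e hj hje ν := by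
  obtain ⟨d, hd⟩ := mem_range_of_isIntegral_tensor_fractionRing (P := C.A'' hj) (Q := K)
    (C.Ξ e hj hje ν) (C.isIntegral_Ξ e hj hje hν)
  exact ⟨d, hd, fun d' hd' => C.ιD_injective e hj hje (hd'.trans hd.symm)⟩

/-- `θ₀(ν) ∈ D₀` for `ν ∈ m` integral over `k°`: the unique preimage of `Ξ(ν)`. [folklore] -/
def θ₀ {ν : m} (hν : IsIntegral (baseRing m V) ν) : C.D₀ e hj hje :=
  (C.exists_ιD_eq_Ξ e hj hje hν).choose

/-- `ι_D(θ₀ ν) = Ξ ν`. [folklore] -/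
theorem ιD_θ₀ {ν : m} (hν : IsIntegral (baseRing m V) ν) :
    C.ιD e hj hje (C.θ₀ e hj hje hν) = C.Ξ e hj hje ν :=
  (C.exists_ιD_eq_Ξ e hj hje hν).choose_spec.1

/-- `θ₀` is multiplicative. [folklore] -/
theorem θ₀_mul {ν ν' : m} (hν : IsIntegral (baseRing m V) ν)
    (hν' : IsIntegral (baseRing m V) ν') :
    C.θ₀ e hj hje (hν.mul hν') = C.θ₀ e hj hje hν * C.θ₀ e hj hje hν' :=
  C.ιD_injective e hj hje (by rw [map_mul, C.ιD_θ₀, C.ιD_θ₀, C.ιD_θ₀, map_mul])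

/-- `θ₀` is additive. [folklore] -/
theorem θ₀_add {ν ν' : m} (hν : IsIntegral (baseRing m V) ν)
    (hν' : IsIntegral (baseRing m V) ν') :
    C.θ₀ e hj hje (hν.add hν') = C.θ₀ e hj hje hν + C.θ₀ e hj hje hν' :=
  C.ιD_injective e hj hje (by rw [map_add, C.ιD_θ₀, C.ιD_θ₀, C.ιD_θ₀, map_add])

/-! ### `m° = N[1/f]` and the denominator `f` -/

include C in
/-- **Temkin's open-immersion lemma** applied to `m°`: there is `f ∈ m°`, `f ≠ 0`, integral over
`k°`, a unit of `m°`, with `m° = {a / fⁿ : a integral over k°}`. [cite: Temkin2013, proof of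
Thm. 4.1.1 Step 3 (arXiv:0804.1554v3 p. 49)] via `Temkin2013_valuationRingOpen_holds` (if the
`f` provided there is `0`, then `m° = N` and `f = 1` works). -/
theorem exists_fO : ∃ f : m, f ≠ 0 ∧ IsIntegral (baseRing m V) f ∧ f ∈ O ∧ f⁻¹ ∈ O ∧
    ∀ x : m, x ∈ O ↔ ∃ a : m, IsIntegral (baseRing m V) a ∧ ∃ n : ℕ, x = a / f ^ n := by
  haveI := C.hfin
  obtain ⟨f, hi, hf, hfi, hchar⟩ := Temkin2013_valuationRingOpen_holds k m inferInstance V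
    (by rw [C.hdim]; exact lt_of_lt_of_eq (WithBot.coe_lt_coe.mpr (ENat.coe_lt_top 1)) WithBot.coe_top)
    O C.hOV
  by_cases h0 : f = 0
  · subst h0
    refine ⟨1, one_ne_zero, isIntegral_one, O.one_mem, by rw [inv_one]; exact O.one_mem,
      fun x => ⟨fun hx => ?_, ?_⟩⟩
    · obtain ⟨a, ha, n, rfl⟩ := (hchar x).mp hx
      rcases n with _ | n
      · exact ⟨a, ha, 0, by simp⟩
      · exact ⟨0, isIntegral_zero, 0, by simp⟩
    · rintro ⟨a, ha, n, rfl⟩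
      rw [one_pow, div_one]
      exact (hchar a).mpr ⟨a, ha, 0, by simp⟩
  · exact ⟨f, h0, hi, hf, hfi, hchar⟩

/-- The denominator `f` of `m° = N[1/f]`. [folklore] -/
def fO : m := C.exists_fO.choose

/-- `f ≠ 0`. [folklore] -/
theorem fO_ne_zero : C.fO ≠ 0 := C.exists_fO.choose_spec.1

/-- `f` is integral over `k°`. [folklore] -/
theorem fO_isIntegral : IsIntegral (baseRing m V) C.fO := C.exists_fO.choose_spec.2.1

/-- `f ∈ m°`. [folklore] -/
theorem fO_mem : C.fO ∈ O := C.exists_fO.choose_spec.2.2.1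

/-- `f⁻¹ ∈ m°`. [folklore] -/
theorem fO_inv_mem : C.fO⁻¹ ∈ O := C.exists_fO.choose_spec.2.2.2.1

/-- `m° = N[1/f]`. [folklore] -/
theorem mem_O_iff (x : m) : x ∈ O ↔
    ∃ a : m, IsIntegral (baseRing m V) a ∧ ∃ n : ℕ, x = a / C.fO ^ n :=
  C.exists_fO.choose_spec.2.2.2.2 x

include C in
/-- Integral elements lie in `m°`. [folklore] -/
theorem mem_O_of_isIntegral {a : m} (ha : IsIntegral (baseRing m V) a) : a ∈ O :=
  (C.mem_O_iff a).mpr ⟨a, ha, 0, by simp⟩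

end Ambient

end DecompChart

end Literature.AlgebraicGeometry.Resolution
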